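import Literature.Geometry.Riemannian.ModelTransportMetric
import Literature.Geometry.Riemannian.PerelmanNoncollapsingAssembly
import Literature.Geometry.Riemannian.PullbackFamilyDerivative
import HarnessLib

/-!
# Perelman's no local collapsing: reduction of the general-model statement to manifolds
# modelled on `ℝ^m` (transport along the identity to the Euclidean-model structure)

The named fact `perelman_noLocalCollapsing` (`CanonicalNeighbourhoods.lean`; Perelman 2002, §4,
Thm. 4.1) quantifies over closed manifolds modelled on an ARBITRARY finite-dimensional real normed
space `E` (model with corners `I : ModelWithCorners ℝ E H`, boundaryless), whereas the analysis
of its proof in the tree — the chart formula for the Riemannian measure, Green's identity, the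
evolution of the volume, the conservation of `∫ u dV` and the integration layer of the entropy
formula (`ConjugateHeatConservation.lean`, `PerelmanEntropyDerivative.lean`,
`PerelmanNoncollapsingAssembly.lean`) — lives on manifolds modelled on `EuclideanSpace ℝ (Fin m)`.
The two settings differ only formally: composing the model with a linear isomorphism
`e : E ≃L[ℝ] ℝ^m` (Mathlib's `I.transContinuousLinearEquiv e`, same charts, same smooth maps)
and transporting the flow along the identity (`PseudoRiemannianMetric.transportCLE`,
`ModelTransportMetric.lean`: same scalar products read through `e`, same distance, balls, volume
and curvature bounds) turns any Ricci flow into a Ricci flow on a manifold modelled on `ℝ^m` with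
the same `κ`-noncollapsing properties. This file PROVES:

* `IsRicciFlow.transportCLE` — the transport `t ↦ (g t).transportCLE e` of a Ricci flow, with its
  Levi-Civita connections, is a Ricci flow on `(M, I.trans e)` (smoothness of the pulled-back
  family `IsContMDiffFamilyOn.pullbackBilin`; the equation by naturality of the Ricci tensor,
  `ricci_comap_apply`, as in Topping 2006, §5.2, Step 2 (iv) for the DeTurck diffeomorphisms);
* `isKappaNoncollapsed_of_transportCLE` — `κ`-noncollapsing of the transported flow gives
  `κ`-noncollapsing of the original one (same balls, volumes, curvature bounds, dimension);
* `perelman_noLocalCollapsing_of_euclideanModel` — **the Euclidean-model statement of Perelman's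
  theorem (all `m`, all closed manifolds modelled on `ℝ^m`) implies `perelman_noLocalCollapsing`**;
* `perelman_noLocalCollapsing_of_conjugateHeat_euclidean` — hence the named fact follows from
  (CH) the backward solvability of the conjugate heat equation and (EF)(b) the monotonicity of
  `𝒲` along it, BOTH ONLY FOR closed manifolds modelled on `ℝ^m`
  (`exists_isKappaNoncollapsed_of_conjugateHeat`), the conservation (EF)(a) being proved there.

Everything is proved; no definitions, no named facts; the named fact is NOT discharged.

## References

* G. Perelman, *The entropy formula for the Ricci flow and its geometric applications*,
  arXiv:math/0211159 (2002), §4, Thm. 4.1, Def. 4.2 ("it is also clear that `α²g_ij` is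
  `κ`-noncollapsed … whenever `g_ij` is": invariance bookkeeping of the same kind). [Perelman2002]
* P. Topping, *Lectures on the Ricci flow*, LMS Lecture Note Series 325, CUP 2006, §5.2, Step 2
  (pull-back of a Ricci flow along diffeomorphisms is a Ricci flow), §8.3, Thm. 8.3.1. [Topping2006]
* B. O'Neill, *Semi-Riemannian geometry* (1983), Ch. 3, Prop. 3.59, pp. 90–91. [ONeill1983]
-/

noncomputable section

open Set Function Manifold Bundle MeasureTheory Module Filter
open scoped Manifold ContDiff Topology ENNReal

namespace Literature.Geometry.Riemannian

open Lorentzian Lorentzian.PseudoRiemannianMetric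

universe u v w

section Flow

variable {E : Type*} [NormedAddCommGroup E] [NormedSpace ℝ E] [FiniteDimensional ℝ E]
  [CompleteSpace E]
  {E' : Type*} [NormedAddCommGroup E'] [NormedSpace ℝ E'] [FiniteDimensional ℝ E']
  [CompleteSpace E']
  {H : Type*} [TopologicalSpace H] {I : ModelWithCorners ℝ E H}
  {M : Type*} [TopologicalSpace M] [ChartedSpace H M] [IsManifold I ∞ M]
  (e : E ≃L[ℝ] E')
  {g : ℝ → PseudoRiemannianMetric I ∞ E (TangentSpace I : M → Type _)}
  {cov : ℝ → CovariantDerivative I E (TangentSpace I : M → Type _)} {S : Set ℝ}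

/-- **The transport of a Ricci flow to the structure with model `I.trans e` is a Ricci flow**
(with its Levi-Civita connections): the family `t ↦ (g t).transportCLE e = id^* g_t` is smooth on
`M × S` (`IsContMDiffFamilyOn.pullbackBilin` along the constant family of maps `id`), and
`∂ₜ (id^* g_t)(X, Y) = ∂ₜ g_t(e⁻¹X, e⁻¹Y) = −2 Ric_{g_t}(e⁻¹X, e⁻¹Y) = −2 Ric_{id^* g_t}(X, Y)` by the
naturality of the Ricci tensor (`ricci_comap_apply`) and its independence of the Levi-Civita
witness (`IsLeviCivita.ricci_eq_ricci`) — the argument of Topping 2006, §5.2, Step 2 (iv) for a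
time-independent diffeomorphism. [cite: Topping2006, §5.2, Step 2 (iv)] [cite: ONeill1983, Ch. 3, Prop. 3.59] -/
theorem IsRicciFlow.transportCLE (h : IsRicciFlow g cov S) :
    IsRicciFlow (fun t ↦ (g t).transportCLE e)
      (fun t ↦ haveI := ((g t).transportCLE e).hasLeviCivita; ((g t).transportCLE e).leviCivita)
      S := by
  refine ⟨?_, ?_, ?_⟩
  · -- smoothness on `M × S`: the pullback of a smooth family along `id`
    have hψ : ContMDiffOn ((I.transContinuousLinearEquiv e).prod 𝓘(ℝ, ℝ)) I ∞
        (fun q : M × ℝ ↦ (fun (_ : ℝ) (x : M) ↦ x) q.2 q.1) (univ ×ˢ S) :=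
      ((contMDiff_id_transCLE I e).comp contMDiff_fst).contMDiffOn
    exact h.smooth.pullbackBilin (ψ := fun (_ : ℝ) (x : M) ↦ x) hψ
  · intro t _
    haveI := ((g t).transportCLE e).hasLeviCivita
    exact ((g t).transportCLE e).isLeviCivita_leviCivita_holds
  · intro t ht x X Y
    haveI := ((g t).transportCLE e).hasLeviCivita
    haveI := (g t).hasLeviCivita
    have h2 : (2 : ℕ∞ω) ≤ (∞ : ℕ∞ω) := WithTop.coe_le_coe.mpr le_top
    have hval : (fun s : ℝ ↦ ((g s).transportCLE e).val x X Y) =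
        fun s ↦ (g s).val x (e.symm X) (e.symm Y) := by
      funext s; rw [transportCLE_val_apply]
    haveI : ((g t).comap (I' := I.transContinuousLinearEquiv e) contMDiff_pullbackBilin_holds
        (id : M → M) (contMDiff_id_transCLE I e) (injective_mfderiv_id_transCLE I e)
        (finrank_eq_of_cle e)).HasLeviCivita := ((g t).transportCLE e).hasLeviCivita
    have hRic' : ((g t).transportCLE e).ricci x X Y = (g t).ricci x (e.symm X) (e.symm Y) := by
      have h1 : ((g t).transportCLE e).ricci x X Y =
          (g t).ricci ((id : M → M) x) (mfderiv (I.transContinuousLinearEquiv e) I (id : M → M) x X)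
            (mfderiv (I.transContinuousLinearEquiv e) I (id : M → M) x Y) :=
        (g t).ricci_comap_apply contMDiff_pullbackBilin_holds (contMDiff_id_transCLE I e)
          (injective_mfderiv_id_transCLE I e) (finrank_eq_of_cle e) x X Y
      rw [h1, mfderiv_id_transCLE_apply, mfderiv_id_transCLE_apply]
      rfl
    have hRic : ((g t).transportCLE e).leviCivita.ricci x X Y =
        (cov t).ricci x (e.symm X) (e.symm Y) := by
      rw [← PseudoRiemannianMetric.ricci_apply, hRic', (h.isLeviCivita t ht).ricci_eq_ricci h2 x]
    rw [hval]
    change HasDerivWithinAt (fun s ↦ (g s).val x (e.symm X) (e.symm Y))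
      (-2 * ((g t).transportCLE e).leviCivita.ricci x X Y) S t
    rw [hRic]
    exact h.hasDerivWithinAt t ht x (e.symm X) (e.symm Y)

variable [T2Space M] [MeasurableSpace M] [BorelSpace M]

/-- **`κ`-noncollapsing is invariant under the transport** (in the useful direction): if the
transported flow `(g t).transportCLE e` with Levi-Civita connections `cov'` is `κ`-noncollapsed on
the scale `r₀` over the time set `S` (parabolic form `IsKappaNoncollapsed`), and `(g, cov)` has
Riemannian metrics with Levi-Civita witnesses on `S`, then `(g, cov)` is `κ`-noncollapsed on the
scale `r₀`: the geodesic balls (`ball_transportCLE`), their volumes (`vol_transportCLE`), the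
frame-wise curvature bounds (`curvatureBoundedOn_transportCLE_iff`) and the dimension agree.
[cite: Perelman2002, §4, Def. 4.2] -/
theorem isKappaNoncollapsed_of_transportCLE [CompactSpace M]
    {cov' : ℝ → CovariantDerivative (I.transContinuousLinearEquiv e) E'
      (TangentSpace (I.transContinuousLinearEquiv e) : M → Type _)}
    (hRiem : ∀ t ∈ S, (g t).IsRiemannian) (hcov : ∀ t ∈ S, (g t).IsLeviCivita (cov t))
    (hcov' : ∀ t ∈ S, ((g t).transportCLE e).IsLeviCivita (cov' t)) {κ r₀ : ℝ}
    (hκ : IsKappaNoncollapsed (fun t ↦ (g t).transportCLE e) cov' S κ r₀) :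
    IsKappaNoncollapsed g cov S κ r₀ := by
  intro x₀ t₀ hS hcurv
  have ht₀ : t₀ ∈ S := hS ⟨by nlinarith [sq_nonneg r₀], le_rfl⟩
  have hb : ∀ t ∈ S, ((g t).transportCLE e).ball x₀ (ENNReal.ofReal r₀) =
      (g t).ball x₀ (ENNReal.ofReal r₀) := fun t ht ↦ ball_transportCLE e (hRiem t ht) x₀ _
  have h := hκ x₀ t₀ hS fun t ht ↦ by
    rw [hb t (hS ht), curvatureBoundedOn_transportCLE_iff e (hcov t (hS ht)) (hcov' t (hS ht))]
    exact hcurv t ht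
  rw [finrank_eq_of_cle e] at h
  simp only at h
  rwa [hb t₀ ht₀, vol_transportCLE e (hRiem t₀ ht₀)] at h

end Flow

/-! ### The Euclidean-model statement implies the general one -/

/-- **Perelman's no local collapsing theorem I for manifolds modelled on `ℝ^m` implies the
general statement `perelman_noLocalCollapsing`.** Hypothesis: for every `m`, every closed
manifold modelled on `EuclideanSpace ℝ (Fin m)` (boundaryless model, any Borel structure), every
`T > 0` and every Ricci flow of Riemannian metrics on `[0, T)`, there is `κ > 0` with
`κ`-noncollapsing on all scales `< √T`. Proof: given a flow on a closed manifold modelled on `E`,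
transport it along the identity to the structure with model `I.trans e`,
`e : E ≃L[ℝ] ℝ^{dim E}` (`IsRicciFlow.transportCLE`), apply the hypothesis, and transport the
conclusion back (`isKappaNoncollapsed_of_transportCLE`). [cite: Perelman2002, §4, Thm. 4.1] -/
theorem perelman_noLocalCollapsing_of_euclideanModel
    (hE : ∀ (m : ℕ) {H : Type v} [TopologicalSpace H]
      (I : ModelWithCorners ℝ (EuclideanSpace ℝ (Fin m)) H) [I.Boundaryless]
      (M : Type w) [TopologicalSpace M] [T2Space M] [SecondCountableTopology M] [CompactSpace M]
      [ChartedSpace H M] [IsManifold I ∞ M] [MeasurableSpace M] [BorelSpace M] (T : ℝ), 0 < T →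
      ∀ (g : ℝ → PseudoRiemannianMetric I ∞ (EuclideanSpace ℝ (Fin m)) (TangentSpace I : M → Type _))
        (cov : ℝ → CovariantDerivative I (EuclideanSpace ℝ (Fin m)) (TangentSpace I : M → Type _)),
        IsRicciFlow g cov (Ico 0 T) → (∀ t ∈ Ico 0 T, (g t).IsRiemannian) →
          ∃ κ : ℝ, 0 < κ ∧ ∀ r₀ : ℝ, 0 < r₀ → r₀ < Real.sqrt T →
            IsKappaNoncollapsed g cov (Ico 0 T) κ r₀) :
    perelman_noLocalCollapsing.{u, v, w} := by
  intro E _ _ _ H _ I _ M _ _ _ _ _ _ _ _ T hT g cov hflow hRiem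
  haveI : CompleteSpace E := FiniteDimensional.complete ℝ E
  -- the Euclidean model of the same dimension
  set e : E ≃L[ℝ] EuclideanSpace ℝ (Fin (finrank ℝ E)) := toEuclidean with he
  set I' := I.transContinuousLinearEquiv e with hI'
  haveI : I'.Boundaryless := ⟨by
    rw [hI', ModelWithCorners.transContinuousLinearEquiv_range, I.range_eq_univ, image_univ,
      e.surjective.range_eq]⟩
  -- transport the flow, apply the hypothesis, transport back
  have hflow' := hflow.transportCLE e
  have hRiem' : ∀ t ∈ Ico 0 T, ((g t).transportCLE e).IsRiemannian := fun t ht ↦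
    isRiemannian_transportCLE e (hRiem t ht)
  obtain ⟨κ, hκ, hnc⟩ := hE (finrank ℝ E) I' M T hT (fun t ↦ (g t).transportCLE e) _ hflow' hRiem'
  refine ⟨κ, hκ, fun r₀ hr₀ hr₀T ↦ ?_⟩
  exact isKappaNoncollapsed_of_transportCLE e hRiem hflow.isLeviCivita hflow'.isLeviCivita
    (hnc r₀ hr₀ hr₀T)

/-- **Perelman's no local collapsing theorem I from the conjugate heat flow and the entropy
formula on manifolds modelled on `ℝ^m`** (Perelman 2002, §3.1, (3.4) and §4, Thm. 4.1; Topping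
2006, Rem. 8.2.5, Prop. 8.2.1, (8.3.10), Thm. 8.3.1). The hypotheses are those of
`exists_isKappaNoncollapsed_of_conjugateHeat`, over all closed manifolds modelled on
`EuclideanSpace ℝ (Fin m)` (all `m`) carrying a Ricci flow of Riemannian metrics on `[0, T)`, and
all `0 < t₀ < T`:
* `hCH` — every smooth positive `u₁` is the value at `t₀` of a positive `u`, `C^∞` on
  `M × [0, t₀]`, solving the conjugate heat equation `∂ₜu = −Δ_{g(t)}u + Ru` on `[0, t₀]`;
* `hEF` — along every such `u` and for every `τ > 0`, `t ↦ 𝒲(g(t), f(t), τ + t₀ − t)` is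
  non-decreasing on `[0, t₀]`, `f(t) = −log u(t) − (m/2) log(4π(τ + t₀ − t))` (reduced to the
  POINTWISE Prop. 8.2.6 by `IsRicciFlow.monotoneOn_wEntropy_of_conjugateHeatOp_nonpos`).
Conclusion: `perelman_noLocalCollapsing` in full generality (every model space), by
`perelman_noLocalCollapsing_of_euclideanModel`. NOT a discharge: (CH) and (EF)(b) remain.
[cite: Perelman2002, §3.1, (3.4); §4, Thm. 4.1] [cite: Topping2006, §8.2, Prop. 8.2.1, Rem. 8.2.5; §8.3, Thm. 8.3.1] -/
theorem perelman_noLocalCollapsing_of_conjugateHeat_euclidean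
    (hCH : ∀ (m : ℕ) {H : Type v} [TopologicalSpace H]
      (I : ModelWithCorners ℝ (EuclideanSpace ℝ (Fin m)) H) [I.Boundaryless]
      (M : Type w) [TopologicalSpace M] [T2Space M] [SecondCountableTopology M] [CompactSpace M]
      [ChartedSpace H M] [IsManifold I ∞ M] [MeasurableSpace M] [BorelSpace M] (T : ℝ), 0 < T →
      ∀ (g : ℝ → PseudoRiemannianMetric I ∞ (EuclideanSpace ℝ (Fin m)) (TangentSpace I : M → Type _))
        (cov : ℝ → CovariantDerivative I (EuclideanSpace ℝ (Fin m)) (TangentSpace I : M → Type _)),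
        IsRicciFlow g cov (Ico 0 T) → (∀ t ∈ Ico 0 T, (g t).IsRiemannian) →
        ∀ t₀ ∈ Ioo 0 T, ∀ u₁ : M → ℝ, ContMDiff I 𝓘(ℝ, ℝ) ∞ u₁ → (∀ x, 0 < u₁ x) →
          ∃ u : ℝ → M → ℝ, u t₀ = u₁ ∧ (∀ t ∈ Icc 0 t₀, ∀ x, 0 < u t x) ∧
            ContMDiffOn (I.prod 𝓘(ℝ, ℝ)) 𝓘(ℝ, ℝ) ∞ (fun p : M × ℝ ↦ u p.2 p.1)
              (univ ×ˢ Icc 0 t₀) ∧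
            ∀ t ∈ Icc 0 t₀, ∀ x, derivWithin (fun s ↦ u s x) (Icc 0 t₀) t =
              -(g t).laplaceBeltrami (u t) x + (g t).scalarCurvatureWith (cov t) x * u t x)
    (hEF : ∀ (m : ℕ) {H : Type v} [TopologicalSpace H]
      (I : ModelWithCorners ℝ (EuclideanSpace ℝ (Fin m)) H) [I.Boundaryless]
      (M : Type w) [TopologicalSpace M] [T2Space M] [SecondCountableTopology M] [CompactSpace M]
      [ChartedSpace H M] [IsManifold I ∞ M] [MeasurableSpace M] [BorelSpace M] (T : ℝ), 0 < T →
      ∀ (g : ℝ → PseudoRiemannianMetric I ∞ (EuclideanSpace ℝ (Fin m)) (TangentSpace I : M → Type _))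
        (cov : ℝ → CovariantDerivative I (EuclideanSpace ℝ (Fin m)) (TangentSpace I : M → Type _)),
        IsRicciFlow g cov (Ico 0 T) → (∀ t ∈ Ico 0 T, (g t).IsRiemannian) →
        ∀ t₀ ∈ Ioo 0 T, ∀ u : ℝ → M → ℝ, (∀ t ∈ Icc 0 t₀, ∀ x, 0 < u t x) →
          ContMDiffOn (I.prod 𝓘(ℝ, ℝ)) 𝓘(ℝ, ℝ) ∞ (fun p : M × ℝ ↦ u p.2 p.1)
            (univ ×ˢ Icc 0 t₀) →
          (∀ t ∈ Icc 0 t₀, ∀ x, derivWithin (fun s ↦ u s x) (Icc 0 t₀) t =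
            -(g t).laplaceBeltrami (u t) x + (g t).scalarCurvatureWith (cov t) x * u t x) →
          ∀ τ : ℝ, 0 < τ →
            MonotoneOn (fun t ↦ (g t).wEntropy (cov t)
              (fun x ↦ -Real.log (u t x) - (m : ℝ) / 2 * Real.log (4 * Real.pi * (τ + t₀ - t)))
              (τ + t₀ - t)) (Icc 0 t₀)) :
    perelman_noLocalCollapsing.{u, v, w} :=
  perelman_noLocalCollapsing_of_euclideanModel fun m _H _ I _ M _ _ _ _ _ _ _ _ T hT g cov hflow hRiem ↦
    exists_isKappaNoncollapsed_of_conjugateHeat hT g cov hflow hRiem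
      (hCH m I M T hT g cov hflow hRiem) (hEF m I M T hT g cov hflow hRiem)

end Literature.Geometry.Riemannian

end
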